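import Summits.AnomalousDissipation.AnomalousDissipation.Theorems.SawtoothPulseCascadeK1LocalisedCascadeThinStripStepsOsc
import Summits.AnomalousDissipation.AnomalousDissipation.Theorems.SawtoothPulseCascadeK1LocalisedCascadeThinRatioStepsOsc

/-!
# K1loc — THE FOUR THIN WINDOWS OF A TAIL PHASE (T-H, S-V, O-V, C-H) AT `K = 2000k`, OSCILLATORY GRADE (parameters of record)

Prover lane on the crux `K1LocalisedCascade` (stmt-AnomalousDissipation-19491), route `SawtoothPulseCascade`
(S-B/S-C assembly seat; the LEDGER ASSEMBLY, thin tail, numeric layer).  A THIN phase `j ≥ 12` of the ledger moves the strip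
threshold by the full factor `γ² − 3 = 61`: `K_{j+1} = 61K_j`; the cone is pinned at the slope `16/125` (main modes at slopes
`∈ [√17 − 4, 4 − √15]`), the off-cone class is `O = [16|k₀| ≤ 125|k₁|]` (`⊇` the closer's `13/10·|k₀| < 8|k₁|`).  With `K_j = 2000k`
(`K_12 = 800·25¹⁰` is divisible by `2000`, and so is every `K_j = 61^{j−12}K_12`) the four windows of the phase, with the integer
parameters of this seat's design note (kit/thin_design2.py), are the following instances of `…ThinStripStepsOsc` / `…ThinRatioStepsOsc`
(shape `γ = 8, d = 2, N₀ = 1, ρ_N = 2`; all separation / cut-off-fraction side conditions discharged for every `k ≥ 1`):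
* (T-H) `lowFibre_hstep_thin_le`: `T_j(15608k) ≤ S_j(2000k) + ((√J_T + √O_j(2000k))² + far)` — window `K′ = 15608k = 7.804K`,
  head step `s = 5k`, `H = 12`, `θ = 5/6`, `(c_n,c_d) = (4,5)` (`r* = 9`);
* (S-V) `strip_vstep_thin_le`: `S_{j+1}(122000k) ≤ T_j(15608k) + ((√J_S + √C_j(2002k))² + far)` — `122000k = 61K`, fibres from `15608k`,
  `s = 39k`, `H = 12`, `θ = 7/8`, `(4,5)`; feed `C_j(Y) = Σ'[Y ≤ |k₀| ∧ 16|k₁| ≤ 125|k₀|]‖𝓕b_j‖²` at `Y = 2002k`;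
* (O-V) `offCone_vstep_thin_le`: `O_{j+1}(122000k) ≤ (√J_O + √C_j(2002k))² + far` — class `(16,125)` at `X = 122000k`, slow blocks from
  `Λ₀ = 15616k`, `θ = 9/10`, `(6,7)` (`r* = 13`);
* (C-H) `subcone_hstep_thin_le`: `C_j(2002k) ≤ (√J_C + √A′_j(2002k))² + far` — class `(16,125)` of `b_j` from `Λ₀ = 2002k`, `θ = 7/8`, `(11,12)`
  (`r* = 23`), feed = the FLAT shell `A′_j(Y) = Σ'[Y ≤ |k₀| ∧ 2|k₀| ≤ 15|k₁|]‖𝓕a_j‖²` (`…FlatShellOsc`).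
The junk terms `J` are the closed forms of the two generic files with these parameters substituted (rounding target `η` free).
No definitions; no statement about the crux. [cite: Grafakos2014, Prop. 3.1.2 (5), Prop. 3.2.7 (3), §3.1.3] [problem: turb]
-/

-- `Summit.<Summit>.<Problem>`: single-conjunct summit, the duplicate namespace segment is deliberate.
set_option linter.dupNamespace false

noncomputable section

namespace Summit.AnomalousDissipation.AnomalousDissipation.Theorems.SawtoothPulseCascade.K1Window

open MeasureTheory Set Filter Topology UnitAddTorus Function Complex Metric
open scoped Real ENNReal
open Literature.Analysis Literature.Analysis.FunctionSpaces Literature.Analysis.FunctionSpaces.Torus Literature.Analysis.FluidPDE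
open Literature.Analysis.FluidPDE.ShearStage
open Literature.Analysis.FluidPDE.SawtoothCascade Literature.Analysis.FluidPDE.SawtoothCascade.CascadeParams
open Summit.AnomalousDissipation.AnomalousDissipation.Theorems.SawtoothPulseCascade.K1Start
open Summit.AnomalousDissipation.AnomalousDissipation.Theorems.SawtoothPulseCascade.K1Flat
open Summit.AnomalousDissipation.AnomalousDissipation.Theorems.SawtoothPulseCascade.K1Ledger.From

section Cascade

variable (P : CascadeParams)

set_option maxHeartbeats 800000 in
/-- **(T-H) OF A THIN PHASE** (see the file header): window `15608k`, strip floor `2000k`, head `s = 5k`, `H = 12`, `θ = 5/6`,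
off-cone slope `(16,125)`, cut-off fraction `4/5`, `M_b` blocks, rounding target `η`. [cite: Grafakos2014, Prop. 3.1.2 (5), Prop. 3.2.7 (3), §3.1.3] -/
theorem lowFibre_hstep_thin_le (hγ : P.γ = 8) (hδ₀ : 0 < P.δ₀) (hd : P.d = 2) (hN₀ : P.N₀ = 1) (hρN : P.ρN = 2)
    (a b : ℕ → UnitAddTorus (Fin 2) → ℝ) (has : ∀ j, IsSmooth (a j)) (h0 : a 0 = datum)
    (hb : ∀ j, b j = a j ∘ shearMap 0 1 (amp ⟨P.U j, P.U_periodic j, P.contDiff_U (P.δ_pos hδ₀ (by rw [hd]; norm_num) j)⟩ P.γ))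
    (hab : ∀ j, a (j + 1) = b j ∘ shearMap 1 0 (amp ⟨P.U j, P.U_periodic j, P.contDiff_U (P.δ_pos hδ₀ (by rw [hd]; norm_num) j)⟩ P.γ))
    (j : ℕ) {k : ℕ} (hk : 2 ≤ k) (Mb : ℕ) {η : ℝ} (hη : 0 < η)
    (hMδ : max 1 (Real.sqrt (2 * Real.log (1 / η))) * P.δ j < π / 2) :
    ∑' q : Fin 2 → ℤ, (if |q 1| < ((15608 * k : ℕ) : ℤ) then (1 : ℝ) else 0) * ‖mFourierCoeff (fun x => (b j x : ℂ)) q‖ ^ 2 ≤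
      ∑' q : Fin 2 → ℤ, (if |q 0| < ((2000 * k : ℕ) : ℤ) then (1 : ℝ) else 0) * ‖mFourierCoeff (fun x => (a j x : ℂ)) q‖ ^ 2 +
      ((Real.sqrt (3 * ((((5 : ℕ) : ℝ) + ((4 : ℕ) : ℝ)) / (((5 : ℕ) : ℝ) - ((4 : ℕ) : ℝ))) ^ 2 *
            (4 / 3 * ((((1 - ((5 : ℕ) : ℝ) / ((6 : ℕ) : ℝ)) * ((15608 * k : ℕ) : ℝ) +
                  (1 + ((5 : ℕ) : ℝ) / ((6 : ℕ) : ℝ)) * ((((8 : ℕ) : ℝ)) * (((2000 * k : ℕ) : ℝ) + ((5 * k : ℕ) : ℝ) * ((12 : ℕ) : ℝ)))) /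
                ((1 - ((5 : ℕ) : ℝ) / ((6 : ℕ) : ℝ)) * (((8 : ℕ) : ℝ) * ((2000 * k : ℕ) : ℝ) - ((15608 * k : ℕ) : ℝ)))) * π * ((8 : ℕ) : ℝ) * η *
                (((2000 * k : ℕ) : ℝ) + ((5 * k : ℕ) : ℝ) * ((12 : ℕ) : ℝ)) / P.N j * 2 ^ Mb) ^ 2 +
              Mb * (2 * P.N j / (π * ((1 - ((5 : ℕ) : ℝ) / ((6 : ℕ) : ℝ)) * (((8 : ℕ) : ℝ) * ((2000 * k : ℕ) : ℝ) - ((15608 * k : ℕ) : ℝ))))) ^ 2 +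
              Mb * (4 * P.N j * (((1 - ((5 : ℕ) : ℝ) / ((6 : ℕ) : ℝ)) * ((15608 * k : ℕ) : ℝ) +
                  (1 + ((5 : ℕ) : ℝ) / ((6 : ℕ) : ℝ)) * (((8 : ℕ) : ℝ) * (((2000 * k : ℕ) : ℝ) + ((5 * k : ℕ) : ℝ) * ((12 : ℕ) : ℝ)))) /
                ((1 - ((5 : ℕ) : ℝ) / ((6 : ℕ) : ℝ)) * (((8 : ℕ) : ℝ) * ((2000 * k : ℕ) : ℝ) - ((15608 * k : ℕ) : ℝ)))) /
                (π * ((1 - ((5 : ℕ) : ℝ) / ((6 : ℕ) : ℝ)) * (((8 : ℕ) : ℝ) * ((2000 * k : ℕ) : ℝ) - ((15608 * k : ℕ) : ℝ))))) +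
              Mb * (8 * P.N j * (((1 - ((5 : ℕ) : ℝ) / ((6 : ℕ) : ℝ)) * ((15608 * k : ℕ) : ℝ) +
                  (1 + ((5 : ℕ) : ℝ) / ((6 : ℕ) : ℝ)) * (((8 : ℕ) : ℝ) * (((2000 * k : ℕ) : ℝ) + ((5 * k : ℕ) : ℝ) * ((12 : ℕ) : ℝ)))) /
                ((1 - ((5 : ℕ) : ℝ) / ((6 : ℕ) : ℝ)) * (((8 : ℕ) : ℝ) * ((2000 * k : ℕ) : ℝ) - ((15608 * k : ℕ) : ℝ)))) ^ 2 *
                Real.sqrt (4 * (max 1 (Real.sqrt (2 * Real.log (1 / η))) * P.δ j) /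
                  (π * ((1 - ((5 : ℕ) : ℝ) / ((6 : ℕ) : ℝ)) * (((8 : ℕ) : ℝ) * ((2000 * k : ℕ) : ℝ) - ((15608 * k : ℕ) : ℝ))))) +
                8 * (((1 - ((5 : ℕ) : ℝ) / ((6 : ℕ) : ℝ)) * ((15608 * k : ℕ) : ℝ) +
                  (1 + ((5 : ℕ) : ℝ) / ((6 : ℕ) : ℝ)) * (((8 : ℕ) : ℝ) * (((2000 * k : ℕ) : ℝ) + ((5 * k : ℕ) : ℝ) * ((12 : ℕ) : ℝ)))) /
                ((1 - ((5 : ℕ) : ℝ) / ((6 : ℕ) : ℝ)) * (((8 : ℕ) : ℝ) * ((2000 * k : ℕ) : ℝ) - ((15608 * k : ℕ) : ℝ)))) ^ 2 *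
                  (max 1 (Real.sqrt (2 * Real.log (1 / η))) * P.δ j) / π))) +
          Real.sqrt (∑' q : Fin 2 → ℤ, (if ((2000 * k : ℕ) : ℤ) ≤ |q 0| ∧ ((16 : ℕ) : ℤ) * |q 0| ≤ ((125 : ℕ) : ℤ) * |q 1| then (1 : ℝ) else 0) *
            ‖mFourierCoeff (fun x => (a j x : ℂ)) q‖ ^ 2)) ^ 2 +
        ((1 + P.γ) ^ (2 * j) / (((2000 * k + 5 * k * min Mb 12) * 2 ^ (Mb - 12) : ℕ) : ℝ)) ^ 2) := by
  have hγ' : P.γ = ((8 : ℕ) : ℝ) := by rw [hγ]; norm_num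
  have hd' : 0 < P.d := by rw [hd]; norm_num
  have hN₀' : 1 ≤ P.N₀ := by rw [hN₀]
  have hρN' : 1 ≤ P.ρN := by rw [hρN]; norm_num
  exact lowFibre_hstep_thinOsc_le P hγ' hδ₀ hd' hN₀' hρN' a b has h0 hb hab j (K := 15608 * k) (u' := 16) (v' := 125)
    (θn := 5) (θd := 6) (cn := 4) (cd := 5) (Λ0 := 2000 * k) (s := 5 * k) (H := 12) (by norm_num) (by norm_num) (by norm_num)
    (by norm_num) (by norm_num) (by omega)
    (by norm_num; omega) (by norm_num) (by norm_num; omega) (by norm_num; omega) (by omega) (by norm_num; omega)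
    Mb hη hMδ


set_option maxHeartbeats 800000 in
/-- **(S-V) OF A THIN PHASE** (see the file header): strip `122000k = 61K`, fibre floor `15608k`, head `s = 39k`, `H = 12`, `θ = 7/8`,
feed `C_j(2002k)` (class `16|k₁| ≤ 125|k₀|` of `b_j`), cut-off fraction `4/5`. [cite: Grafakos2014, Prop. 3.1.2 (5), Prop. 3.2.7 (3), §3.1.3] -/
theorem strip_vstep_thin_le (hγ : P.γ = 8) (hδ₀ : 0 < P.δ₀) (hd : P.d = 2) (hN₀ : P.N₀ = 1) (hρN : P.ρN = 2)
    (a b : ℕ → UnitAddTorus (Fin 2) → ℝ) (has : ∀ j, IsSmooth (a j)) (h0 : a 0 = datum)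
    (hb : ∀ j, b j = a j ∘ shearMap 0 1 (amp ⟨P.U j, P.U_periodic j, P.contDiff_U (P.δ_pos hδ₀ (by rw [hd]; norm_num) j)⟩ P.γ))
    (hab : ∀ j, a (j + 1) = b j ∘ shearMap 1 0 (amp ⟨P.U j, P.U_periodic j, P.contDiff_U (P.δ_pos hδ₀ (by rw [hd]; norm_num) j)⟩ P.γ))
    (j : ℕ) {k : ℕ} (hk : 2 ≤ k) (Mb : ℕ) {η : ℝ} (hη : 0 < η)
    (hMδ : max 1 (Real.sqrt (2 * Real.log (1 / η))) * P.δ j < π / 2) :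
    ∑' q : Fin 2 → ℤ, (if |q 0| < ((122000 * k : ℕ) : ℤ) then (1 : ℝ) else 0) * ‖mFourierCoeff (fun x => (a (j + 1) x : ℂ)) q‖ ^ 2 ≤
      ∑' q : Fin 2 → ℤ, (if |q 1| < ((15608 * k : ℕ) : ℤ) then (1 : ℝ) else 0) * ‖mFourierCoeff (fun x => (b j x : ℂ)) q‖ ^ 2 +
      ((Real.sqrt (3 * ((((5 : ℕ) : ℝ) + ((4 : ℕ) : ℝ)) / (((5 : ℕ) : ℝ) - ((4 : ℕ) : ℝ))) ^ 2 *
            (4 / 3 * ((((1 - ((7 : ℕ) : ℝ) / ((8 : ℕ) : ℝ)) * ((122000 * k : ℕ) : ℝ) +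
                  (1 + ((7 : ℕ) : ℝ) / ((8 : ℕ) : ℝ)) * (((8 : ℕ) : ℝ) * (((15608 * k : ℕ) : ℝ) + ((39 * k : ℕ) : ℝ) * ((12 : ℕ) : ℝ)))) /
                ((1 - ((7 : ℕ) : ℝ) / ((8 : ℕ) : ℝ)) * (((8 : ℕ) : ℝ) * ((15608 * k : ℕ) : ℝ) - ((122000 * k : ℕ) : ℝ)))) * π * ((8 : ℕ) : ℝ) * η *
                (((15608 * k : ℕ) : ℝ) + ((39 * k : ℕ) : ℝ) * ((12 : ℕ) : ℝ)) / P.N j * 2 ^ Mb) ^ 2 +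
              Mb * (2 * P.N j / (π * ((1 - ((7 : ℕ) : ℝ) / ((8 : ℕ) : ℝ)) * (((8 : ℕ) : ℝ) * ((15608 * k : ℕ) : ℝ) - ((122000 * k : ℕ) : ℝ))))) ^ 2 +
              Mb * (4 * P.N j * (((1 - ((7 : ℕ) : ℝ) / ((8 : ℕ) : ℝ)) * ((122000 * k : ℕ) : ℝ) +
                  (1 + ((7 : ℕ) : ℝ) / ((8 : ℕ) : ℝ)) * (((8 : ℕ) : ℝ) * (((15608 * k : ℕ) : ℝ) + ((39 * k : ℕ) : ℝ) * ((12 : ℕ) : ℝ)))) /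
                ((1 - ((7 : ℕ) : ℝ) / ((8 : ℕ) : ℝ)) * (((8 : ℕ) : ℝ) * ((15608 * k : ℕ) : ℝ) - ((122000 * k : ℕ) : ℝ)))) /
                (π * ((1 - ((7 : ℕ) : ℝ) / ((8 : ℕ) : ℝ)) * (((8 : ℕ) : ℝ) * ((15608 * k : ℕ) : ℝ) - ((122000 * k : ℕ) : ℝ))))) +
              Mb * (8 * P.N j * (((1 - ((7 : ℕ) : ℝ) / ((8 : ℕ) : ℝ)) * ((122000 * k : ℕ) : ℝ) +
                  (1 + ((7 : ℕ) : ℝ) / ((8 : ℕ) : ℝ)) * (((8 : ℕ) : ℝ) * (((15608 * k : ℕ) : ℝ) + ((39 * k : ℕ) : ℝ) * ((12 : ℕ) : ℝ)))) /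
                ((1 - ((7 : ℕ) : ℝ) / ((8 : ℕ) : ℝ)) * (((8 : ℕ) : ℝ) * ((15608 * k : ℕ) : ℝ) - ((122000 * k : ℕ) : ℝ)))) ^ 2 *
                Real.sqrt (4 * (max 1 (Real.sqrt (2 * Real.log (1 / η))) * P.δ j) /
                  (π * ((1 - ((7 : ℕ) : ℝ) / ((8 : ℕ) : ℝ)) * (((8 : ℕ) : ℝ) * ((15608 * k : ℕ) : ℝ) - ((122000 * k : ℕ) : ℝ))))) +
                8 * (((1 - ((7 : ℕ) : ℝ) / ((8 : ℕ) : ℝ)) * ((122000 * k : ℕ) : ℝ) +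
                  (1 + ((7 : ℕ) : ℝ) / ((8 : ℕ) : ℝ)) * (((8 : ℕ) : ℝ) * (((15608 * k : ℕ) : ℝ) + ((39 * k : ℕ) : ℝ) * ((12 : ℕ) : ℝ)))) /
                ((1 - ((7 : ℕ) : ℝ) / ((8 : ℕ) : ℝ)) * (((8 : ℕ) : ℝ) * ((15608 * k : ℕ) : ℝ) - ((122000 * k : ℕ) : ℝ)))) ^ 2 *
                  (max 1 (Real.sqrt (2 * Real.log (1 / η))) * P.δ j) / π))) +
          Real.sqrt (∑' q : Fin 2 → ℤ, (if ((2002 * k : ℕ) : ℤ) ≤ |q 0| ∧ ((16 : ℕ) : ℤ) * |q 1| ≤ ((125 : ℕ) : ℤ) * |q 0| then (1 : ℝ) else 0) *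
            ‖mFourierCoeff (fun x => (b j x : ℂ)) q‖ ^ 2)) ^ 2 +
        ((1 + P.γ) ^ (2 * (j + 1)) / (((15608 * k + 39 * k * min Mb 12) * 2 ^ (Mb - 12) : ℕ) : ℝ)) ^ 2) := by
  have hγ' : P.γ = ((8 : ℕ) : ℝ) := by rw [hγ]; norm_num
  have hd' : 0 < P.d := by rw [hd]; norm_num
  have hN₀' : 1 ≤ P.N₀ := by rw [hN₀]
  have hρN' : 1 ≤ P.ρN := by rw [hρN]; norm_num
  exact strip_vstep_thinOsc_le P hγ' hδ₀ hd' hN₀' hρN' a b has h0 hb hab j (K := 122000 * k) (u' := 16) (v' := 125)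
    (θn := 7) (θd := 8) (cn := 4) (cd := 5) (Λ0 := 15608 * k) (s := 39 * k) (H := 12) (by norm_num) (by norm_num) (by norm_num)
    (by norm_num) (by norm_num) (by omega)
    (by norm_num; omega) (by norm_num) (by norm_num; omega) (by norm_num; omega) (by omega) (by norm_num; omega)
    (Y := 2002 * k) (by norm_num; omega) Mb hη hMδ

set_option maxHeartbeats 800000 in
/-- **(O-V) OF A THIN PHASE** (see the file header): off-cone class `(16,125)` at `X = 122000k`, slow blocks from `Λ₀ = 15616k`, `θ = 9/10`,
feed `C_j(2002k)`, cut-off fraction `6/7`. [cite: Grafakos2014, Prop. 3.1.2 (5), Prop. 3.2.7 (3), §3.1.3] -/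
theorem offCone_vstep_thin_le (hγ : P.γ = 8) (hδ₀ : 0 < P.δ₀) (hd : P.d = 2) (hN₀ : P.N₀ = 1) (hρN : P.ρN = 2)
    (a b : ℕ → UnitAddTorus (Fin 2) → ℝ) (has : ∀ j, IsSmooth (a j)) (h0 : a 0 = datum)
    (hb : ∀ j, b j = a j ∘ shearMap 0 1 (amp ⟨P.U j, P.U_periodic j, P.contDiff_U (P.δ_pos hδ₀ (by rw [hd]; norm_num) j)⟩ P.γ))
    (hab : ∀ j, a (j + 1) = b j ∘ shearMap 1 0 (amp ⟨P.U j, P.U_periodic j, P.contDiff_U (P.δ_pos hδ₀ (by rw [hd]; norm_num) j)⟩ P.γ))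
    (j : ℕ) {k : ℕ} (hk : 2 ≤ k) (Mb : ℕ) {η : ℝ} (hη : 0 < η)
    (hMδ : max 1 (Real.sqrt (2 * Real.log (1 / η))) * P.δ j < π / 2) :
    ∑' q : Fin 2 → ℤ, (if ((122000 * k : ℕ) : ℤ) ≤ |q 0| ∧ ((16 : ℕ) : ℤ) * |q 0| ≤ ((125 : ℕ) : ℤ) * |q 1| then (1 : ℝ) else 0) *
        ‖mFourierCoeff (fun x => (a (j + 1) x : ℂ)) q‖ ^ 2 ≤
      (Real.sqrt (3 * ((((7 : ℕ) : ℝ) + ((6 : ℕ) : ℝ)) / (((7 : ℕ) : ℝ) - ((6 : ℕ) : ℝ))) ^ 2 *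
            (4 / 3 * ((((((125 : ℕ) : ℝ) + ((16 : ℕ) : ℝ) * ((8 : ℕ) : ℝ)) * ((10 : ℕ) : ℝ) + ((9 : ℕ) : ℝ) * ((16 * 8 - 125 : ℕ) : ℝ)) / ((((10 : ℕ) : ℝ) - ((9 : ℕ) : ℝ)) * ((16 * 8 - 125 : ℕ) : ℝ))) *
                π * ((8 : ℕ) : ℝ) * η * ((15616 * k : ℕ) : ℝ) / P.N j * 2 ^ Mb) ^ 2 +
              9 * (2 * P.N j / (π * ((((10 : ℕ) : ℝ) - ((9 : ℕ) : ℝ)) * ((16 * 8 - 125 : ℕ) : ℝ) * ((15616 * k : ℕ) : ℝ) / (2 * ((10 : ℕ) : ℝ) * ((16 : ℕ) : ℝ))))) ^ 2 +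
              9 * (4 * P.N j * (((((125 : ℕ) : ℝ) + ((16 : ℕ) : ℝ) * ((8 : ℕ) : ℝ)) * ((10 : ℕ) : ℝ) + ((9 : ℕ) : ℝ) * ((16 * 8 - 125 : ℕ) : ℝ)) / ((((10 : ℕ) : ℝ) - ((9 : ℕ) : ℝ)) * ((16 * 8 - 125 : ℕ) : ℝ))) /
                (π * ((((10 : ℕ) : ℝ) - ((9 : ℕ) : ℝ)) * ((16 * 8 - 125 : ℕ) : ℝ) * ((15616 * k : ℕ) : ℝ) / (2 * ((10 : ℕ) : ℝ) * ((16 : ℕ) : ℝ))))) +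
              Mb * (8 * P.N j * (((((125 : ℕ) : ℝ) + ((16 : ℕ) : ℝ) * ((8 : ℕ) : ℝ)) * ((10 : ℕ) : ℝ) + ((9 : ℕ) : ℝ) * ((16 * 8 - 125 : ℕ) : ℝ)) / ((((10 : ℕ) : ℝ) - ((9 : ℕ) : ℝ)) * ((16 * 8 - 125 : ℕ) : ℝ))) ^ 2 *
                Real.sqrt (4 * (max 1 (Real.sqrt (2 * Real.log (1 / η))) * P.δ j) /
                  (π * ((((10 : ℕ) : ℝ) - ((9 : ℕ) : ℝ)) * ((16 * 8 - 125 : ℕ) : ℝ) * ((15616 * k : ℕ) : ℝ) / (2 * ((10 : ℕ) : ℝ) * ((16 : ℕ) : ℝ))))) +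
                8 * (((((125 : ℕ) : ℝ) + ((16 : ℕ) : ℝ) * ((8 : ℕ) : ℝ)) * ((10 : ℕ) : ℝ) + ((9 : ℕ) : ℝ) * ((16 * 8 - 125 : ℕ) : ℝ)) / ((((10 : ℕ) : ℝ) - ((9 : ℕ) : ℝ)) * ((16 * 8 - 125 : ℕ) : ℝ))) ^ 2 *
                  (max 1 (Real.sqrt (2 * Real.log (1 / η))) * P.δ j) / π))) +
          Real.sqrt (∑' q : Fin 2 → ℤ, (if ((2002 * k : ℕ) : ℤ) ≤ |q 0| ∧ ((16 : ℕ) : ℤ) * |q 1| ≤ ((125 : ℕ) : ℤ) * |q 0| then (1 : ℝ) else 0) *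
            ‖mFourierCoeff (fun x => (b j x : ℂ)) q‖ ^ 2)) ^ 2 +
        ((1 + P.γ) ^ (2 * (j + 1)) / ((15616 * k * 9 ^ Mb / 8 ^ Mb : ℕ) : ℝ)) ^ 2 := by
  have hγ' : P.γ = ((8 : ℕ) : ℝ) := by rw [hγ]; norm_num
  have hd' : 0 < P.d := by rw [hd]; norm_num
  have hN₀' : 1 ≤ P.N₀ := by rw [hN₀]
  have hρN' : 1 ≤ P.ρN := by rw [hρN]; norm_num
  exact ratioClass_vstep_thinOsc_le P hγ' hδ₀ hd' hN₀' hρN' a b has h0 hb hab j (u := 16) (v := 125) (X := 122000 * k)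
    (u' := 16) (v' := 125) (Y := 2002 * k) (θn := 9) (θd := 10) (cn := 6) (cd := 7) (Λ0 := 15616 * k) (by norm_num) (by norm_num)
    (by norm_num) (by norm_num) (by norm_num) (by norm_num) (by norm_num) (by norm_num) (by omega) (by omega)
    (by norm_num) (by norm_num; omega) (by norm_num) (by norm_num; omega) (by norm_num; omega) Mb hη hMδ

set_option maxHeartbeats 800000 in
/-- **(C-H) OF A THIN PHASE** (see the file header): class `16|k₁| ≤ 125|k₀|` of `b_j` from the fibre floor `2002k`, slow blocks, `θ = 7/8`,
feed = the flat shell `A′_j(2002k)`, cut-off fraction `11/12`. [cite: Grafakos2014, Prop. 3.1.2 (5), Prop. 3.2.7 (3), §3.1.3] -/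
theorem subcone_hstep_thin_le (hγ : P.γ = 8) (hδ₀ : 0 < P.δ₀) (hd : P.d = 2) (hN₀ : P.N₀ = 1) (hρN : P.ρN = 2)
    (a b : ℕ → UnitAddTorus (Fin 2) → ℝ) (has : ∀ j, IsSmooth (a j)) (h0 : a 0 = datum)
    (hb : ∀ j, b j = a j ∘ shearMap 0 1 (amp ⟨P.U j, P.U_periodic j, P.contDiff_U (P.δ_pos hδ₀ (by rw [hd]; norm_num) j)⟩ P.γ))
    (hab : ∀ j, a (j + 1) = b j ∘ shearMap 1 0 (amp ⟨P.U j, P.U_periodic j, P.contDiff_U (P.δ_pos hδ₀ (by rw [hd]; norm_num) j)⟩ P.γ))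
    (j : ℕ) {k : ℕ} (hk : 2 ≤ k) (Mb : ℕ) {η : ℝ} (hη : 0 < η)
    (hMδ : max 1 (Real.sqrt (2 * Real.log (1 / η))) * P.δ j < π / 2) :
    ∑' q : Fin 2 → ℤ, (if ((2002 * k : ℕ) : ℤ) ≤ |q 0| ∧ ((16 : ℕ) : ℤ) * |q 1| ≤ ((125 : ℕ) : ℤ) * |q 0| then (1 : ℝ) else 0) *
        ‖mFourierCoeff (fun x => (b j x : ℂ)) q‖ ^ 2 ≤
      (Real.sqrt (3 * ((((12 : ℕ) : ℝ) + ((11 : ℕ) : ℝ)) / (((12 : ℕ) : ℝ) - ((11 : ℕ) : ℝ))) ^ 2 *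
            (4 / 3 * ((((((125 : ℕ) : ℝ) + ((16 : ℕ) : ℝ) * ((8 : ℕ) : ℝ)) * ((8 : ℕ) : ℝ) + ((7 : ℕ) : ℝ) * ((16 * 8 - 125 : ℕ) : ℝ)) / ((((8 : ℕ) : ℝ) - ((7 : ℕ) : ℝ)) * ((16 * 8 - 125 : ℕ) : ℝ))) *
                π * ((8 : ℕ) : ℝ) * η * ((2002 * k : ℕ) : ℝ) / P.N j * 2 ^ Mb) ^ 2 +
              9 * (2 * P.N j / (π * ((((8 : ℕ) : ℝ) - ((7 : ℕ) : ℝ)) * ((16 * 8 - 125 : ℕ) : ℝ) * ((2002 * k : ℕ) : ℝ) / (2 * ((8 : ℕ) : ℝ) * ((16 : ℕ) : ℝ))))) ^ 2 +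
              9 * (4 * P.N j * (((((125 : ℕ) : ℝ) + ((16 : ℕ) : ℝ) * ((8 : ℕ) : ℝ)) * ((8 : ℕ) : ℝ) + ((7 : ℕ) : ℝ) * ((16 * 8 - 125 : ℕ) : ℝ)) / ((((8 : ℕ) : ℝ) - ((7 : ℕ) : ℝ)) * ((16 * 8 - 125 : ℕ) : ℝ))) /
                (π * ((((8 : ℕ) : ℝ) - ((7 : ℕ) : ℝ)) * ((16 * 8 - 125 : ℕ) : ℝ) * ((2002 * k : ℕ) : ℝ) / (2 * ((8 : ℕ) : ℝ) * ((16 : ℕ) : ℝ))))) +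
              Mb * (8 * P.N j * (((((125 : ℕ) : ℝ) + ((16 : ℕ) : ℝ) * ((8 : ℕ) : ℝ)) * ((8 : ℕ) : ℝ) + ((7 : ℕ) : ℝ) * ((16 * 8 - 125 : ℕ) : ℝ)) / ((((8 : ℕ) : ℝ) - ((7 : ℕ) : ℝ)) * ((16 * 8 - 125 : ℕ) : ℝ))) ^ 2 *
                Real.sqrt (4 * (max 1 (Real.sqrt (2 * Real.log (1 / η))) * P.δ j) /
                  (π * ((((8 : ℕ) : ℝ) - ((7 : ℕ) : ℝ)) * ((16 * 8 - 125 : ℕ) : ℝ) * ((2002 * k : ℕ) : ℝ) / (2 * ((8 : ℕ) : ℝ) * ((16 : ℕ) : ℝ))))) +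
                8 * (((((125 : ℕ) : ℝ) + ((16 : ℕ) : ℝ) * ((8 : ℕ) : ℝ)) * ((8 : ℕ) : ℝ) + ((7 : ℕ) : ℝ) * ((16 * 8 - 125 : ℕ) : ℝ)) / ((((8 : ℕ) : ℝ) - ((7 : ℕ) : ℝ)) * ((16 * 8 - 125 : ℕ) : ℝ))) ^ 2 *
                  (max 1 (Real.sqrt (2 * Real.log (1 / η))) * P.δ j) / π))) +
          Real.sqrt (∑' q : Fin 2 → ℤ, (if ((2002 * k : ℕ) : ℤ) ≤ |q 0| ∧ ((2 : ℕ) : ℤ) * |q 0| ≤ ((15 : ℕ) : ℤ) * |q 1| then (1 : ℝ) else 0) *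
            ‖mFourierCoeff (fun x => (a j x : ℂ)) q‖ ^ 2)) ^ 2 +
        ((1 + P.γ) ^ (2 * j) / ((2002 * k * 9 ^ Mb / 8 ^ Mb : ℕ) : ℝ)) ^ 2 := by
  have hγ' : P.γ = ((8 : ℕ) : ℝ) := by rw [hγ]; norm_num
  have hd' : 0 < P.d := by rw [hd]; norm_num
  have hN₀' : 1 ≤ P.N₀ := by rw [hN₀]
  have hρN' : 1 ≤ P.ρN := by rw [hρN]; norm_num
  exact ratioClass_hstep_thinOsc_le P hγ' hδ₀ hd' hN₀' hρN' a b has h0 hb hab j (u := 16) (v := 125)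
    (u' := 2) (v' := 15) (Y := 2002 * k) (θn := 7) (θd := 8) (cn := 11) (cd := 12) (Λ0 := 2002 * k) (by norm_num) (by norm_num)
    (by norm_num) (by norm_num) (by norm_num) (by norm_num) (by norm_num) (by norm_num) (by omega)
    (by norm_num) (by norm_num; omega) (by norm_num) (by norm_num; omega) le_rfl Mb hη hMδ

end Cascade

end Summit.AnomalousDissipation.AnomalousDissipation.Theorems.SawtoothPulseCascade.K1Window
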